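import Summits.HubbardSuperconductivity.HubbardSuperconductivity.Theorems.TwTipContinuation.Negative.TipCornerTools
import Summits.HubbardSuperconductivity.HubbardSuperconductivity.Theorems.TwTipContinuation.Negative.SeedContinuity

/-!
# `TwTipContinuation` (stmt-HubbardSuperconductivity-1700) — the corner `g = 0` in normal form on BOTH sides
# (negative-side support, cdisprove gen 3)

Eventual (in even `L`) corollaries, on the literal route terms, of the one-side Danskin facts of
`Negative/SeedContinuity.lean`:

* `suppressionCost_of_everyGSOrder_pure` + `everyGSOrder_pure_iff_suppressionCost` — the
  suppression-cost hypothesis of `everyGSOrder_pure_of_suppressionCost` (a linear sector-energy cost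
  `c η_L L²` of some small REPULSIVE d-wave pair term `+(η_L/L²)ΔᴴΔ`) is EQUIVALENT to the every-GS
  d-wave order bound of the pure torus, i.e. (`summitMatrix_iff_everyGSOrder`) to the summit's conclusion
  at `(U,δ)`: energy-inequality reformulations of the corner (the isogap line's sliver stub) are the
  conclusion itself, not a weakening of it;
* `existsGSOrder_pure_of_uniformRungs`, `existsAdmissibleLRO_of_uniformRungs` — g-UNIFORM rungs (one
  constant and one threshold `L₀` for all seeds `g ∈ (0, g₁]`: the `CornerPersistence` shape) prove that
  SOME normalised sector ground state of the pure torus is ordered, eventually in even `L`, hence that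
  there EXISTS an admissible ground-state sequence with d-wave pair-field long-range order (an
  "∃-ground-state summit"); the crux's conclusion asks it of EVERY admissible sequence, and the
  every/some gap at `g = 0` is invisible to all hypotheses living at `g > 0` (level crossing AT `0`,
  cf. `not_abstractTipShape`).

Danskin (1966) / Griffiths (1964); Tasaki (2020) §2.1–2.2; Friedli–Velenik (2017) §3.7.2 (LRO as a
liminf). Folklore; no definition is introduced.
-/

noncomputable section

namespace Summit.HubbardSuperconductivity.TwTipContinuation.Negative

open Matrix Filter Finset Topology
open Literature.MathematicalPhysics.QuantumLattice Literature.Probability.LatticeModels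
open Summit.HubbardSuperconductivity.HubbardSuperconductivity.Theses.ThermalWedge
open scoped ComplexOrder

/-! ### Eventual corollaries on the literal route terms -/

/-- **The suppression-cost formulation IS the conclusion (converse of
`everyGSOrder_pure_of_suppressionCost`).** The every-GS order bound of the pure torus gives, eventually
in even `L`, a repulsive seed `−η_L < 0` whose sector-energy cost is at least `(c/2)·η_L·L²`. [folklore] -/
theorem suppressionCost_of_everyGSOrder_pure {U δ : ℝ} (hδ : -1 ≤ δ)
    (h : ∃ c : ℝ, 0 < c ∧ ∃ L₀ : ℕ, ∀ (L : ℕ) [NeZero L], L₀ ≤ L → Even L →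
        ∀ ψ : Fock (Orb (FermionTorus 2 L)), star ψ ⬝ᵥ ψ = 1 →
          IsGroundStateInSector (hubbardTorus 2 L 1 U) (2 * ⌊(1 - δ) * (L : ℝ) ^ 2 / 2⌋₊) 0 ψ →
            c * (L : ℝ) ^ 4 ≤ (expect ((pairField dWaveFormFactor L)ᴴ * pairField dWaveFormFactor L) ψ).re) :
    ∃ c : ℝ, 0 < c ∧ ∃ L₀ : ℕ, ∀ (L : ℕ) [NeZero L], L₀ ≤ L → Even L →
      ∃ η : ℝ, 0 < η ∧ c * η * (L : ℝ) ^ 2 ≤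
        (Matrix.minEnergyOn (hubbardTorus 2 L 1 U - (((-η) / (L : ℝ) ^ 2 : ℝ) : ℂ) • ((pairField dWaveFormFactor L)ᴴ * pairField dWaveFormFactor L)) (szSector (2 * ⌊(1 - δ) * (L : ℝ) ^ 2 / 2⌋₊) 0)) -
        (Matrix.minEnergyOn (hubbardTorus 2 L 1 U - ((0 / (L : ℝ) ^ 2 : ℝ) : ℂ) • ((pairField dWaveFormFactor L)ᴴ * pairField dWaveFormFactor L)) (szSector (2 * ⌊(1 - δ) * (L : ℝ) ^ 2 / 2⌋₊) 0)) := by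
  obtain ⟨c, hc, L₀, h⟩ := (everyGSOrder_zero_iff (δ := δ)).2 h
  refine ⟨c / 2, half_pos hc, L₀, fun L _ hL₀ hE => ?_⟩
  have hn : ⌊(1 - δ) * (L : ℝ) ^ 2 / 2⌋₊ ≤ Fintype.card (FermionTorus 2 L) := by
    rw [Summit.HubbardSuperconductivity.NoGo.card_fermionTorus_two]
    exact Summit.HubbardSuperconductivity.NoGo.floor_pairNumber_le δ hδ L
  have hL : (0 : ℝ) < (L : ℝ) ^ 4 := by
    have := NeZero.pos L
    positivity
  have hB : c / 2 * (L : ℝ) ^ 4 < c * (L : ℝ) ^ 4 := by nlinarith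
  obtain ⟨η, hη, hcost⟩ := exists_suppressionCost_of_forall_groundState (U := U) hn hB
    (fun ψ hψ hgs => h L hL₀ hE ψ hψ hgs)
  refine ⟨η, hη, ?_⟩
  have hL2 : ((L : ℝ) ^ 2) ≠ 0 := by
    have := NeZero.pos L
    positivity
  calc c / 2 * η * (L : ℝ) ^ 2 = η / (L : ℝ) ^ 2 * (c / 2 * (L : ℝ) ^ 4) := by
        rw [eq_comm, div_mul_eq_mul_div, div_eq_iff hL2]
        ring
    _ ≤ _ := hcost

/-- **Normal form of the corner on the penalty side**: the suppression-cost hypothesis (a linear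
sector-energy cost of some small repulsive d-wave pair term, eventually in even `L`) is EQUIVALENT to the
every-GS d-wave order bound of the pure torus, i.e. (`summitMatrix_iff_everyGSOrder`) to the summit's
conclusion at `(U,δ)`. Energy-inequality reformulations of the corner buy nothing. [folklore] -/
theorem everyGSOrder_pure_iff_suppressionCost {U δ : ℝ} (hδ : -1 ≤ δ) :
    (∃ c : ℝ, 0 < c ∧ ∃ L₀ : ℕ, ∀ (L : ℕ) [NeZero L], L₀ ≤ L → Even L →
        ∀ ψ : Fock (Orb (FermionTorus 2 L)), star ψ ⬝ᵥ ψ = 1 →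
          IsGroundStateInSector (hubbardTorus 2 L 1 U) (2 * ⌊(1 - δ) * (L : ℝ) ^ 2 / 2⌋₊) 0 ψ →
            c * (L : ℝ) ^ 4 ≤ (expect ((pairField dWaveFormFactor L)ᴴ * pairField dWaveFormFactor L) ψ).re) ↔
    (∃ c : ℝ, 0 < c ∧ ∃ L₀ : ℕ, ∀ (L : ℕ) [NeZero L], L₀ ≤ L → Even L →
      ∃ η : ℝ, 0 < η ∧ c * η * (L : ℝ) ^ 2 ≤
        (Matrix.minEnergyOn (hubbardTorus 2 L 1 U - (((-η) / (L : ℝ) ^ 2 : ℝ) : ℂ) • ((pairField dWaveFormFactor L)ᴴ * pairField dWaveFormFactor L)) (szSector (2 * ⌊(1 - δ) * (L : ℝ) ^ 2 / 2⌋₊) 0)) -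
        (Matrix.minEnergyOn (hubbardTorus 2 L 1 U - ((0 / (L : ℝ) ^ 2 : ℝ) : ℂ) • ((pairField dWaveFormFactor L)ᴴ * pairField dWaveFormFactor L)) (szSector (2 * ⌊(1 - δ) * (L : ℝ) ^ 2 / 2⌋₊) 0))) :=
  ⟨suppressionCost_of_everyGSOrder_pure hδ, everyGSOrder_pure_of_suppressionCost⟩

/-- **g-uniform rungs give an ordered ground-state BRANCH of the pure torus.** If, eventually in even
`L`, every normalised sector ground state of `H_L(U,g)` has `c L⁴ ≤ re⟨ΔᴴΔ⟩` UNIFORMLY in the seeds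
`g ∈ (0, g₁]` (the `CornerPersistence` shape: one constant, one threshold `L₀` for all small seeds),
then eventually in even `L` SOME normalised sector ground state of the PURE torus has `c L⁴ ≤ re⟨ΔᴴΔ⟩`.
The crux's conclusion asks this of EVERY ground state; the gap between the two is invisible to every
hypothesis living at `g > 0`. [folklore] -/
theorem existsGSOrder_pure_of_uniformRungs {U δ : ℝ} (hδ : -1 ≤ δ)
    (h : ∃ c : ℝ, 0 < c ∧ ∃ g₁ : ℝ, 0 < g₁ ∧ ∃ L₀ : ℕ, ∀ (L : ℕ) [NeZero L], L₀ ≤ L → Even L →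
        ∀ g ∈ Set.Ioc (0 : ℝ) g₁, ∀ ψ : Fock (Orb (FermionTorus 2 L)), star ψ ⬝ᵥ ψ = 1 →
          IsGroundStateInSector (hubbardTorus 2 L 1 U - ((g / (L : ℝ) ^ 2 : ℝ) : ℂ) • ((pairField dWaveFormFactor L)ᴴ * pairField dWaveFormFactor L)) (2 * ⌊(1 - δ) * (L : ℝ) ^ 2 / 2⌋₊) 0 ψ →
            c * (L : ℝ) ^ 4 ≤ (expect ((pairField dWaveFormFactor L)ᴴ * pairField dWaveFormFactor L) ψ).re) :
    ∃ c : ℝ, 0 < c ∧ ∃ L₀ : ℕ, ∀ (L : ℕ) [NeZero L], L₀ ≤ L → Even L →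
      ∃ ψ : Fock (Orb (FermionTorus 2 L)), star ψ ⬝ᵥ ψ = 1 ∧
        IsGroundStateInSector (hubbardTorus 2 L 1 U) (2 * ⌊(1 - δ) * (L : ℝ) ^ 2 / 2⌋₊) 0 ψ ∧
          c * (L : ℝ) ^ 4 ≤ (expect ((pairField dWaveFormFactor L)ᴴ * pairField dWaveFormFactor L) ψ).re := by
  obtain ⟨c, hc, g₁, hg₁, L₀, h⟩ := h
  refine ⟨c, hc, L₀, fun L _ hL₀ hE => ?_⟩
  have hn : ⌊(1 - δ) * (L : ℝ) ^ 2 / 2⌋₊ ≤ Fintype.card (FermionTorus 2 L) := by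
    rw [Summit.HubbardSuperconductivity.NoGo.card_fermionTorus_two]
    exact Summit.HubbardSuperconductivity.NoGo.floor_pairNumber_le δ hδ L
  obtain ⟨ψ, hψ, hgs, hB⟩ := exists_groundState_order_of_uniformSeeds (U := U) hn hg₁
    (fun g hg0 hg1 ψ hψ hgs => h L hL₀ hE g ⟨hg0, hg1⟩ ψ hψ hgs)
  refine ⟨ψ, hψ, ?_, hB⟩
  simpa only [seededH_zero] using hgs

/-- **… hence an "∃-ground-state summit" at `(U,δ)`**: under g-uniform rungs there EXISTS an admissible
normalised ground-state sequence of the pure torus (prescribed filling on even sides) with d-wave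
pair-field long-range order along even sides — whereas the crux's conclusion (`summitMatrix_iff_everyGSOrder`)
demands it of every admissible sequence. [folklore] -/
theorem existsAdmissibleLRO_of_uniformRungs {U δ : ℝ} (hδ : -1 ≤ δ)
    (h : ∃ c : ℝ, 0 < c ∧ ∃ g₁ : ℝ, 0 < g₁ ∧ ∃ L₀ : ℕ, ∀ (L : ℕ) [NeZero L], L₀ ≤ L → Even L →
        ∀ g ∈ Set.Ioc (0 : ℝ) g₁, ∀ ψ : Fock (Orb (FermionTorus 2 L)), star ψ ⬝ᵥ ψ = 1 →
          IsGroundStateInSector (hubbardTorus 2 L 1 U - ((g / (L : ℝ) ^ 2 : ℝ) : ℂ) • ((pairField dWaveFormFactor L)ᴴ * pairField dWaveFormFactor L)) (2 * ⌊(1 - δ) * (L : ℝ) ^ 2 / 2⌋₊) 0 ψ →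
            c * (L : ℝ) ^ 4 ≤ (expect ((pairField dWaveFormFactor L)ᴴ * pairField dWaveFormFactor L) ψ).re) :
    ∃ (N : ℕ → ℕ) (ψ : ∀ L, Fock (Orb (FermionTorus 2 L))),
      (∀ L, Even L → N L = 2 * ⌊(1 - δ) * (L : ℝ) ^ 2 / 2⌋₊ ∧ star (ψ L) ⬝ᵥ ψ L = 1 ∧
          IsGroundStateInSector (hubbardTorus 2 L 1 U) (N L) 0 (ψ L)) ∧
        HasLongRangeOrder (fun k => halfOpenBox 2 (2 * k))
          (fun k => torusPullback (pairFieldCorr dWaveFormFactor ψ) (2 * k)) := by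
  obtain ⟨c, hc, L₀, hgood⟩ := existsGSOrder_pure_of_uniformRungs hδ h
  -- at every side pick a normalised sector ground state, an ordered one where available
  have hex : ∀ L : ℕ, ∃ ψ : Fock (Orb (FermionTorus 2 L)), star ψ ⬝ᵥ ψ = 1 ∧
      IsGroundStateInSector (hubbardTorus 2 L 1 U) (2 * ⌊(1 - δ) * (L : ℝ) ^ 2 / 2⌋₊) 0 ψ ∧
      (∀ _ : NeZero L, L₀ ≤ L → Even L →
        c * (L : ℝ) ^ 4 ≤ (expect ((pairField dWaveFormFactor L)ᴴ * pairField dWaveFormFactor L) ψ).re) := by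
    intro L
    by_cases hL : L ≠ 0 ∧ L₀ ≤ L ∧ Even L
    · haveI : NeZero L := ⟨hL.1⟩
      obtain ⟨ψ, hψ, hgs, hB⟩ := hgood L hL.2.1 hL.2.2
      exact ⟨ψ, hψ, hgs, fun _ _ _ => hB⟩
    · obtain ⟨ψ, h1, h2⟩ :=
        Summit.HubbardSuperconductivity.NoGo.exists_unit_groundStateInSector_hubbardTorus L 1 U
          (Summit.HubbardSuperconductivity.NoGo.floor_pairNumber_le δ hδ L)
      refine ⟨ψ, h1, h2, fun hne hL₀ hE => absurd ⟨hne.ne, hL₀, hE⟩ hL⟩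
  choose ψ hψu hψgs hψB using hex
  refine ⟨fun L => 2 * ⌊(1 - δ) * (L : ℝ) ^ 2 / 2⌋₊, ψ, fun L _ => ⟨rfl, hψu L, hψgs L⟩, ?_⟩
  change 0 < liminf (fun k : ℕ => (∑ x ∈ halfOpenBox 2 (2 * k), ∑ y ∈ halfOpenBox 2 (2 * k),
          torusPullback (pairFieldCorr dWaveFormFactor ψ) (2 * k) x y) /
        ((halfOpenBox 2 (2 * k)).card : ℝ) ^ 2) atTop
  have hev : ∀ᶠ k in atTop, c ≤ (∑ x ∈ halfOpenBox 2 (2 * k), ∑ y ∈ halfOpenBox 2 (2 * k),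
          torusPullback (pairFieldCorr dWaveFormFactor ψ) (2 * k) x y) /
        ((halfOpenBox 2 (2 * k)).card : ℝ) ^ 2 := by
    refine eventually_atTop.2 ⟨L₀ + 1, fun k hk => ?_⟩
    haveI : NeZero (2 * k) := ⟨by omega⟩
    have hb := hψB (2 * k) inferInstance (by omega) (even_two_mul k)
    rw [lroTerm_eq, le_div_iff₀ (side_pow_pos k)]
    exact hb
  have hev' : ∀ᶠ k in atTop, (∑ x ∈ halfOpenBox 2 (2 * k), ∑ y ∈ halfOpenBox 2 (2 * k),
          torusPullback (pairFieldCorr dWaveFormFactor ψ) (2 * k) x y) /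
        ((halfOpenBox 2 (2 * k)).card : ℝ) ^ 2 ≤
      (∑ e ∈ insert 0 unitSteps, ‖((dWaveFormFactor e / Real.sqrt 2 : ℝ) : ℂ)‖ * 2) ^ 2 := by
    refine eventually_atTop.2 ⟨1, fun k hk => ?_⟩
    haveI : NeZero (2 * k) := ⟨by omega⟩
    rw [lroTerm_eq, div_le_iff₀ (side_pow_pos k)]
    exact expect_pairIntensity_le (2 * k) (ψ (2 * k)) (hψu (2 * k))
  exact lt_of_lt_of_le hc (le_liminf_of_le (isCoboundedUnder_ge_of_eventually_le _ hev') hev)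

end Summit.HubbardSuperconductivity.TwTipContinuation.Negative
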